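import Literature.NumberTheory.Sieve.MoebiusShiftedPrimesMajorArcsSmoothed
import Literature.NumberTheory.LFunctions.ExpSumBoundReduction
import HarnessLib

/-!
# Möbius on shifted primes — Propositions 3.4 and 3.2 of Lichtman 2020 from ANY Vinogradov–Korobov
# input (inexplicit region / Vinogradov's exponential-sum estimate)

Topic `Literature/NumberTheory/Sieve`.  A short companion of `MoebiusShiftedPrimesMajorArcsSmoothed.lean`
(J. D. Lichtman, *Averages of the Möbius function on shifted primes*, Q. J. Math. 73 (2022) 729–757 =
arXiv:2009.08969v2 [Lichtman2020], Propositions 3.2 and 3.4 AS PRINTED, there deduced from Lemma 4.5 =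
`Lichtman2020_primeCharacterSum`, and from Khale's explicit zero-free region `Khale2024_zeroFreeRegion`).
Everything here is PROVED; the file introduces no definition and no named fact.

The only input of the printed Propositions 3.2/3.4 that the tree does not prove is the
Vinogradov–Korobov zero-free region for Dirichlet `L`-functions.  The tree consumes that region through
the parametrised predicate `HasVKZeroFreeRegion c T₀` (`VinogradovKorobovDirichlet.lean`: any constant,
any starting height; Khale's Theorem 1.1 is `HasVKZeroFreeRegion (1/61.5) 10`), and REDUCES it, with
proofs, to Vinogradov's estimate for the zeta sums:

* `hasVKZeroFreeRegion_of_expSumBound` (`RichertBoundsFromExpSum.lean`): Ford's Theorem 2 shape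
  `ExpSumBound C D` (`‖∑_{N<n≤R}(n+u)^{-it}‖ ≤ C N^{1 − log²N/(D log²t)}`, all `1 ≤ N ≤ t`) `⟹`
  `∃ c > 0, HasVKZeroFreeRegion c 21` (Landau–Titchmarsh deduction, Titchmarsh Thm 3.10/§6.19,
  Khale App. B);
* `hasVKZeroFreeRegion_of_vinogradovRange` (`ExpSumBoundReduction.lean`): the same from
  `VinogradovRangeBound K C c`, Vinogradov's estimate in its natural range `N^{K+1/2} ≤ t` only (the
  bounded-`λ` range being van der Corput's, proved there).

This file threads those through Lemma 4.5 (`Lichtman2020.PrimeCharSum.Lichtman2020_primeCharacterSum_of_vk`,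
proved in the tree) and the proved deductions of `MoebiusShiftedPrimesMajorArcsSmoothed.lean`, so that a
proof of Vinogradov's estimate with ANY constants (Vinogradov's mean value theorem + the
Korobov–Vinogradov treatment of `f(x) = −(t/2π) log(x+u)`; Ford 2002 §§2–5, Ivić Ch. 6) closes
Propositions 3.4 and 3.2 of Lichtman's paper as printed:

* `Lichtman2020_liouvilleMeanSquare_of_vk`, `…_of_expSumBound`, `…_of_vinogradovRange` —
  **Proposition 3.4** (`Lichtman2020_liouvilleMeanSquare`);
* `Lichtman2020_majorArcEstimate_of_vk`, `…_of_expSumBound`, `…_of_vinogradovRange` —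
  **Proposition 3.2** (`Lichtman2020_majorArcEstimate`).

So `Lichtman2020_majorArcEstimate_holds` / `Lichtman2020_liouvilleMeanSquare_holds` follow in one line
from any one of: `Khale2024_zeroFreeRegion` (`…_of_khale`), `∃ c > 0, HasVKZeroFreeRegion c T₀`
(`…_of_vk`), `ExpSumBound C D` (`…_of_expSumBound`), `VinogradovRangeBound K C c`
(`…_of_vinogradovRange`).

## References

* J. D. Lichtman, *Averages of the Möbius function on shifted primes*, Q. J. Math. 73 (2022) 729–757,
  arXiv:2009.08969v2: Propositions 3.2, 3.4, Lemma 4.5. [Lichtman2020]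
* T. Khale, *An explicit Vinogradov–Korobov zero-free region for Dirichlet L-functions*, Q. J. Math. 75
  (2024) 299–332, arXiv:2210.06457: Theorem 1.1, (1.4), Appendix B. [Khale2024]
* K. Ford, *Vinogradov's integral and bounds for the Riemann zeta function*, Proc. LMS 85 (2002)
  565–633: Theorem 2, Lemma 7.3. [Ford2002]
-/

noncomputable section

namespace Literature.NumberTheory.Sieve

open Literature.NumberTheory.LFunctions

/-- **Lichtman 2020, Proposition 3.4 AS PRINTED, from a Vinogradov–Korobov zero-free region for
Dirichlet `L`-functions with any constant `c > 0` and any starting height `T₀`** (through Lemma 4.5,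
`Lichtman2020_primeCharacterSum_of_vk`). [cite: Lichtman2020, Proposition 3.4] -/
theorem Lichtman2020_liouvilleMeanSquare_of_vk {c T₀ : ℝ} (hc : 0 < c)
    (hVK : HasVKZeroFreeRegion c T₀) : Lichtman2020_liouvilleMeanSquare :=
  Lichtman2020_liouvilleMeanSquare_of_primeCharacterSum
    (Lichtman2020.PrimeCharSum.Lichtman2020_primeCharacterSum_of_vk hc hVK)

/-- **Lichtman 2020, Proposition 3.2 AS PRINTED, from a Vinogradov–Korobov zero-free region for
Dirichlet `L`-functions with any constant `c > 0` and any starting height `T₀`.**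
[cite: Lichtman2020, Proposition 3.2] -/
theorem Lichtman2020_majorArcEstimate_of_vk {c T₀ : ℝ} (hc : 0 < c)
    (hVK : HasVKZeroFreeRegion c T₀) : Lichtman2020_majorArcEstimate :=
  Lichtman2020_majorArcEstimate_of_primeCharacterSum
    (Lichtman2020.PrimeCharSum.Lichtman2020_primeCharacterSum_of_vk hc hVK)

/-- **Lichtman 2020, Proposition 3.4 AS PRINTED, from Vinogradov's exponential-sum estimate in the
shape of Ford's Theorem 2 with unspecified constants** (`ExpSumBound C D`, `C ≥ 0`, `D > 0`; through
`hasVKZeroFreeRegion_of_expSumBound`). [cite: Lichtman2020, Proposition 3.4]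
[cite: Ford2002, Theorem 2 and Lemma 7.3] -/
theorem Lichtman2020_liouvilleMeanSquare_of_expSumBound {C D : ℝ} (h : ExpSumBound C D) (hC : 0 ≤ C)
    (hD : 0 < D) : Lichtman2020_liouvilleMeanSquare := by
  obtain ⟨c, hc, hVK⟩ := hasVKZeroFreeRegion_of_expSumBound h hC hD
  exact Lichtman2020_liouvilleMeanSquare_of_vk hc hVK

/-- **Lichtman 2020, Proposition 3.2 AS PRINTED, from Vinogradov's exponential-sum estimate in the
shape of Ford's Theorem 2 with unspecified constants** (`ExpSumBound C D`, `C ≥ 0`, `D > 0`).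
[cite: Lichtman2020, Proposition 3.2] [cite: Ford2002, Theorem 2 and Lemma 7.3] -/
theorem Lichtman2020_majorArcEstimate_of_expSumBound {C D : ℝ} (h : ExpSumBound C D) (hC : 0 ≤ C)
    (hD : 0 < D) : Lichtman2020_majorArcEstimate := by
  obtain ⟨c, hc, hVK⟩ := hasVKZeroFreeRegion_of_expSumBound h hC hD
  exact Lichtman2020_majorArcEstimate_of_vk hc hVK

/-- **Lichtman 2020, Proposition 3.4 AS PRINTED, from Vinogradov's estimate in its natural range**
(`VinogradovRangeBound K C c`: `‖∑_{N<n≤R}(n+u)^{-it}‖ ≤ C N^{1 − c log²N/log²t}` for `N^{K+1/2} ≤ t`;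
`K ≥ 1`, `C ≥ 0`, `c > 0`; through `hasVKZeroFreeRegion_of_vinogradovRange`).
[cite: Lichtman2020, Proposition 3.4] [cite: Ford2002, Theorem 2] -/
theorem Lichtman2020_liouvilleMeanSquare_of_vinogradovRange {K : ℕ} (hK : 1 ≤ K) {C c : ℝ}
    (hC : 0 ≤ C) (hc : 0 < c) (h : VinogradovRangeBound K C c) : Lichtman2020_liouvilleMeanSquare := by
  obtain ⟨c', hc', hVK⟩ := hasVKZeroFreeRegion_of_vinogradovRange hK hC hc h
  exact Lichtman2020_liouvilleMeanSquare_of_vk hc' hVK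

/-- **Lichtman 2020, Proposition 3.2 AS PRINTED, from Vinogradov's estimate in its natural range**
(`VinogradovRangeBound K C c`, `K ≥ 1`, `C ≥ 0`, `c > 0`): with this file, an unconditional
`Lichtman2020_majorArcEstimate_holds` needs exactly one of `Khale2024_zeroFreeRegion`,
`∃ c > 0, HasVKZeroFreeRegion c T₀`, `ExpSumBound C D`, `VinogradovRangeBound K C c` — i.e. Vinogradov's
mean value theorem and its consequence for the zeta sums. [cite: Lichtman2020, Proposition 3.2]
[cite: Ford2002, Theorem 2] -/
theorem Lichtman2020_majorArcEstimate_of_vinogradovRange {K : ℕ} (hK : 1 ≤ K) {C c : ℝ}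
    (hC : 0 ≤ C) (hc : 0 < c) (h : VinogradovRangeBound K C c) : Lichtman2020_majorArcEstimate := by
  obtain ⟨c', hc', hVK⟩ := hasVKZeroFreeRegion_of_vinogradovRange hK hC hc h
  exact Lichtman2020_majorArcEstimate_of_vk hc' hVK

end Literature.NumberTheory.Sieve
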